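import Literature.AlgebraicGeometry.Resolution.PlaneNearForms
import Mathlib.RingTheory.Ideal.Maximal

/-!
# `PairwiseCurvedTilingsLC` (crux stmt-MatrixMultiplication-17883), line `LonelyTranslates` (c1):
the ideal of a rational point of affine space is maximal

Helper stub `stub_span_X_sub_C_isMaximal` (H3) of the chart induction (`stub_openPiece`) in the
skeleton `Cruxes/PairwiseCurvedTilingsLC/Lines/LonelyTranslates.lean`.  Pure commutative algebra.

For a field `F` and a point `a ∈ Fᵏ`, the ideal `(w_j - a_j : j < k)` of
`F[w_1, …, w_k] = MvPolynomial (Fin k) F` is maximal: it is the kernel of the surjective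
evaluation `F[w] → F`, `g ↦ g(a)` (`⊇` is clear; `⊆` because `g - g(a) ∈ (w_j - a_j : j)` by
induction on `g`), and the kernel of a surjection onto a field is maximal
(`RingHom.ker_isMaximal_of_surjective`).  This fact is already in the tree, for an arbitrary
index type, as `Literature.AlgebraicGeometry.Resolution.isMaximal_span_range_X_sub_C`; the stub
is its specialisation to the index type `Fin k`.
Elementary, sorry-free, def-free.
-/

set_option linter.dupNamespace false  -- `Summit.<S>.<S>.…` is the mandated namespace

namespace Summit.MatrixMultiplication.MatrixMultiplication.Theorems.PairwiseCurvedTilingsLC.Negative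

/-- STUB `stub_span_X_sub_C_isMaximal` (helper H3 of the chart induction, line `LonelyTranslates`
c1): the ideal `(w_j - a_j : j < k) ⊆ F[w_1, …, w_k]` of the rational point `a ∈ Fᵏ` is maximal —
it is the kernel of the evaluation `g ↦ g(a)` onto the field `F`
(`Literature.AlgebraicGeometry.Resolution.isMaximal_span_range_X_sub_C`). [folklore] -/
theorem stub_span_X_sub_C_isMaximal {F : Type} [Field F] {k : ℕ} (a : Fin k → F) :
    (Ideal.span (Set.range fun j => (MvPolynomial.X j - MvPolynomial.C (a j) :
      MvPolynomial (Fin k) F))).IsMaximal :=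
  Literature.AlgebraicGeometry.Resolution.isMaximal_span_range_X_sub_C a

end Summit.MatrixMultiplication.MatrixMultiplication.Theorems.PairwiseCurvedTilingsLC.Negative
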